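import Mathlib
import Summits.Ventures.HodgeRepro.GaussSumOddConductor

/-!
# GaussSumOddConductorPeriodic — the inner function of the odd reduction is `I`-periodic, and the inner sum is `|I|` times a sum over representatives

Blind re-derivation cell `pub-hodge-repro`, seat night-2 (gen 5).  Target tree path
`lean/Summits/Ventures/HodgeRepro/GaussSumOddConductorPeriodic.lean`.  On gen 1's model (`I · I = 0`,
`ρ(1 + z) = ψ(a z)` on `I`), the function `g(w) = ρ(1 + w) ψ(−a w)` on `A = Ann_ψ(I)` of `GaussSumOddConductor` is
constant on the cosets of `I` (`inner_periodic`: `(1 + w + z) = (1 + w)(1 + z (1 + w)^{−1})`, and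
`ψ(a z (1 + w)^{−1}) ψ(−a z) = ψ(w · (−a z (1 + w)^{−1})) = 1` because `w` annihilates `I`); hence, for any set `S` of
coset representatives of `I` in `A` (`∀ w ∈ A, ∃! s ∈ S, w − s ∈ I`), **`∑_{w ∈ A} g(w) = |I| · ∑_{s ∈ S} g(s)`**
(`sum_ann_eq_card_mul_sum_reps`, under `I · I = 0`) — at odd conductor `c = 2m + 1` on `𝒪/𝔭^c`, `S` is a set of lifts of the residue field
and the inner sum is `|𝔭^{m+1}/𝔭^c|` times a quadratic Gauss sum over `𝔽_q`; `LocalChar.eps_eq_card_mul_quad` is the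
root number in that form.

**What this is not.**  The evaluation of the residue-field sum (Gauss's sign) is NOT here.  Nothing here says
anything about the status of the Hodge conjecture for CM abelian varieties, which is NOT proved.
-/

set_option autoImplicit false

noncomputable section

open Finset Classical

namespace Summit.Ventures.HodgeRepro.GaussSumStability

variable {R : Type} [CommRing R] [Fintype R]

omit [Fintype R] in
/-- **`I`-periodicity of the inner function**: for `w ∈ Ann_ψ(I)` with `1 + w` a unit and `z ∈ I`,
`ρ(1 + w + z) ψ(−a (w + z)) = ρ(1 + w) ψ(−a w)`. -/
theorem inner_periodic (ψ : AddChar R ℂ) (I : Ideal R) (ρ : MulChar R ℂ) (a : Rˣ)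
    (hρ : ∀ z ∈ I, ρ (1 + z) = ψ (a * z)) (w : R) (hw : PsiAnn ψ I w) (u : Rˣ) (hu : (u : R) = 1 + w)
    (z : R) (hz : z ∈ I) :
    ρ (1 + w + z) * ψ (-(a : R) * (w + z)) = ρ (1 + w) * ψ (-(a : R) * w) := by
  have hinv := Units.mul_inv u
  have hfac : 1 + w + z = (1 + w) * (1 + z * ((u⁻¹ : Rˣ) : R)) := by
    rw [← hu]
    linear_combination (-z) * hinv
  rw [hfac, map_mul, hρ _ (I.mul_mem_right _ hz)]
  -- `ψ(a z u⁻¹) ψ(−a (w + z)) = ψ(−a w) · ψ(w · (−a z u⁻¹))`, and `w` annihilates `I ∋ −a z u⁻¹`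
  have hann : ψ (w * (-(a : R) * z * ((u⁻¹ : Rˣ) : R))) = 1 :=
    hw _ (by
      have : -(a : R) * z * ((u⁻¹ : Rˣ) : R) = (-(a : R) * ((u⁻¹ : Rˣ) : R)) * z := by ring
      rw [this]
      exact I.mul_mem_left _ hz)
  have key : (a : R) * (z * ((u⁻¹ : Rˣ) : R)) + -(a : R) * (w + z) =
      -(a : R) * w + w * (-(a : R) * z * ((u⁻¹ : Rˣ) : R)) := by
    rw [hu] at hinv
    linear_combination ((a : R) * z) * hinv
  rw [mul_assoc, ← AddChar.map_add_eq_mul, key, AddChar.map_add_eq_mul, hann, mul_one]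

/-- **The inner sum is `|I|` times the sum over a set `S` of coset representatives**: if every `w ∈ A = Ann_ψ(I)` is
`s + z` for exactly one `s ∈ S` (`z ∈ I`), `S ⊆ A`, and `1 + A` consists of units, then
`∑_{w ∈ A} ρ(1 + w) ψ(−a w) = |I| · ∑_{s ∈ S} ρ(1 + s) ψ(−a s)`. -/
theorem sum_ann_eq_card_mul_sum_reps (ψ : AddChar R ℂ) (I : Ideal R) (hI : ∀ z ∈ I, ∀ z' ∈ I, z * z' = 0)
    (ρ : MulChar R ℂ) (a : Rˣ)
    (hρ : ∀ z ∈ I, ρ (1 + z) = ψ (a * z)) (hunit : ∀ w ∈ annSet ψ I, IsUnit (1 + w)) (S : Finset R)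
    (hS : S ⊆ annSet ψ I) (hrep : ∀ w ∈ annSet ψ I, ∃! s, s ∈ S ∧ w - s ∈ I) :
    ∑ w ∈ annSet ψ I, ρ (1 + w) * ψ (-(a : R) * w) =
      (Fintype.card I : ℂ) * ∑ s ∈ S, ρ (1 + s) * ψ (-(a : R) * s) := by
  -- fibre the sum over the representative of each `w`
  classical
  let r : R → R := fun w => if h : ∃ s, s ∈ S ∧ w - s ∈ I then Classical.choose h else 0
  have hr : ∀ w ∈ annSet ψ I, r w ∈ S ∧ w - r w ∈ I := by
    intro w hw
    obtain ⟨s, hs, -⟩ := hrep w hw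
    have hex : ∃ s, s ∈ S ∧ w - s ∈ I := ⟨s, hs⟩
    simp only [r, dif_pos hex]
    exact Classical.choose_spec hex
  have hr_eq : ∀ w ∈ annSet ψ I, ∀ s ∈ S, w - s ∈ I → r w = s := by
    intro w hw s hs hws
    obtain ⟨s', -, huniq⟩ := hrep w hw
    rw [huniq (r w) (hr w hw), huniq s ⟨hs, hws⟩]
  rw [← sum_fiberwise_of_maps_to (g := r) (t := S) (fun w hw => (hr w hw).1)]
  rw [mul_sum]
  refine sum_congr rfl (fun s hs => ?_)
  -- on the fibre of `s` every term equals the term at `s`, and the fibre is `s + I`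
  have hterm : ∀ w ∈ (annSet ψ I).filter (fun w => r w = s),
      ρ (1 + w) * ψ (-(a : R) * w) = ρ (1 + s) * ψ (-(a : R) * s) := by
    intro w hw
    rw [mem_filter] at hw
    obtain ⟨hwA, hws⟩ := hw
    have hz : w - s ∈ I := by rw [← hws]; exact (hr w hwA).2
    have := inner_periodic ψ I ρ a hρ s ((mem_annSet ψ I s).1 (hS hs)) (hunit s (hS hs)).unit
      (IsUnit.unit_spec _) (w - s) hz
    rw [show 1 + s + (w - s) = 1 + w by ring, show s + (w - s) = w by ring] at this
    exact this
  rw [sum_congr rfl hterm, sum_const, nsmul_eq_mul]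
  congr 1
  -- the fibre has exactly `|I|` elements: `z ↦ s + z`
  have hfib : (annSet ψ I).filter (fun w => r w = s) = (univ.filter (fun z => z ∈ I)).image (fun z => s + z) := by
    ext w
    simp only [mem_filter, mem_univ, true_and, mem_image]
    constructor
    · rintro ⟨hwA, hws⟩
      refine ⟨w - s, ?_, by ring⟩
      rw [← hws]; exact (hr w hwA).2
    · rintro ⟨z, hz, rfl⟩
      have hA : s + z ∈ annSet ψ I := by
        rw [mem_annSet]
        intro y hy
        rw [add_mul, AddChar.map_add_eq_mul, ((mem_annSet ψ I s).1 (hS hs)) y hy, one_mul, hI z hz y hy,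
          AddChar.map_zero_eq_one]
      refine ⟨hA, hr_eq _ hA s hs (by rw [add_sub_cancel_left]; exact hz)⟩
  rw [hfib, card_image_of_injective _ (add_right_injective s), Fintype.card_subtype]

end Summit.Ventures.HodgeRepro.GaussSumStability

namespace Summit.Ventures.HodgeRepro.PeriodCloser.LocalChar

open GaussSumStability

variable {R : Type} [CommRing R] [Fintype R]

/-- **Kudla's root number through the representatives**: `ε(½, ρ, ψ) = ρ(ϖ)^n κ · ρ(a)^{−1} ψ(a) · |I| · ∑_{s ∈ S} ρ⁻¹(1 + s) ψ(a s)`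
for any set `S` of coset representatives of `I` in `Ann_ψ(I)`. -/
theorem eps_eq_card_mul_quad (κ : ℂ) (n : ℕ) (ρ : LocalChar R) (ψ : AddChar R ℂ) (I : Ideal R)
    (hI : ∀ z ∈ I, ∀ z' ∈ I, z * z' = 0) (a : Rˣ) (hρ : Primitive ψ I ρ a)
    (hunit : ∀ w ∈ annSet ψ I, IsUnit (1 + w)) (S : Finset R) (hS : S ⊆ annSet ψ I)
    (hrep : ∀ w ∈ annSet ψ I, ∃! s, s ∈ S ∧ w - s ∈ I) :
    eps κ n ρ ψ = ρ.piVal ^ n * κ * ((ρ.unit (a : R))⁻¹ * ψ (a : R) *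
      ((Fintype.card I : ℂ) * ∑ s ∈ S, ρ.unit⁻¹ (1 + s) * ψ ((a : R) * s))) := by
  rw [eps_eq_mul_quad κ n ρ ψ I hI a hρ hunit]
  have := sum_ann_eq_card_mul_sum_reps ψ I hI ρ.unit⁻¹ (-a) (inv_primitive ψ I ρ.unit a hρ) hunit S hS hrep
  simp only [Units.val_neg, neg_neg] at this
  rw [this]

end Summit.Ventures.HodgeRepro.PeriodCloser.LocalChar

end
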